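import Literature.MathematicalPhysics.QuantumFieldTheory.Balaban1983to89.B9Eq315PeriodicReadingZdPer
import Literature.MathematicalPhysics.QuantumFieldTheory.Balaban1983to89.B9Eq326OperatorAssembly
import Literature.MathematicalPhysics.QuantumFieldTheory.Balaban1983to89.B7Eq214FlatQprime
import Literature.MathematicalPhysics.QuantumFieldTheory.Balaban1983to89.B8Eq119TwistedAxial
import Literature.MathematicalPhysics.QuantumFieldTheory.Balaban1983to89.B5Eq172HodgePositivity
import Literature.MathematicalPhysics.QuantumFieldTheory.Balaban1983to89.B9Eq319QprimeLipschitz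

/-!
# `Balaban1983to89.B9Eq319QprimeReadingZdPer` — [Balaban1985BackgroundPropagators] (3.18)–(3.19) p. 393 AT THE FLAT BACKGROUND ON THE TORUS READ ON `ℤᵈ`:
# THE NE9 CHAIN'S GAUGE-PARAMETER AVERAGING `Q′(1)` IS THE N06 JUNCTION'S `Q′_k(1)` — bridge storey S2b, part 1: for a torus site function `u` on the fine
# torus of periods `Lᵏ·m` read in the algebra through the fibre coordinates `φ`, `φ((Q′^{(Lᵏ)}(1)u)(y)) = (Q′_k(1)(read u))(liftSite y)`
# (`B9Eq326OperatorAssembly.QprimeW (Lᵏ) m φ 1` = dag-n06-w4's `QprimeIter (zdBlocking d L) (bgT L 1) k` on the reading), whence the kernels agree: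
# `Q′^{(Lᵏ)}(1)u = 0 ↔ Q′_k(1)(read u) ≡ 0` — the `N(Q′)`-match behind the `R`-letter identification

statement-level skeleton of published theorems with citation tags; proofs where landed; nothing here is a claim about the
Yang–Mills mass gap

`[Balaban1985BackgroundPropagators]` ("B9", CMP **99** (1985) 389–434) (3.18)–(3.19) p. 393 *«Q′_j(U) = Q′(Ūʲ⁻¹)…Q′(Ū)Q′(U)»*, (3.21) p. 394 *«N(Q′) = {λ :
Q′λ = 0}»*; `[Balaban1985Averaging]` ("B7", CMP **98** (1985) 17–51) (2) p. 17 (the blocks `B(y)`), (212) p. 50, p. 39 *«A composition of k operators Q is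
the operator Q_k.»*; `[Balaban1984PropagatorsI]` (1.18) p. 20 *«Q₂ is defined as Q only with the number L replaced by L²»*.  PDF held:
`paper:balaban1985-cmp99-background-propagators` p. 393 (via the tree's `B9Eq319QprimeTorus` ∕ `B7Eq214FlatQprime` docstrings, re-read 2026-08-28).

CITATION HEADER (lean-in-tree rule).  Cell `pub-ymgap` (YM Track A, HUMAN RULINGS D-0062 ∕ D-0149), node N06 = [B9], width seat `pub-ymgap-dag-n06-w3` (g6),
bridge storey S2b part 1 (LOCATED-BRIDGE bus 2026-08-28 14:27Z; memo `HOME/pub-ymgap-dag-n06-w3/BRIDGE-NE9-PERIODIC-g6.md`).  WHY.  The NE9 chain's `R(1)` is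
the orthogonal projection onto `Δ¹(ker Q′^{(L′)}(1))` with `Q′^{(L′)}(1) = B9Eq326OperatorAssembly.QprimeW L′ m φ 1` (ONE averaging step at block size `L′`;
by `B9Eq316TowerFlatIsOneStep` the `k`-level flat letter is this at `L′ = Lᵏ`); dag-n06-w4's `projRPer` projects onto `Δ¹N_𝔤^per(Q′(1))` with
`N^per = gaugeNullPer`, cut out by `QprimeIter (zdBlocking d L) (bgT L 1) k λ = 0`.  THIS FILE proves the two `Q′(1)` agree on the periodic reading,
exactly (not only their kernels): NE9's `Qprime_flat` (block mean over `blockOf`) + `B5Eq155FlatAveragingCommute.sum_blockOf_eq_sum_boxVec` against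
`B7Eq214FlatQprime.QprimeIter_one_eq_sum_blockSites` (the `k`-fold `L`-block mean = the `Lᵏ`-block mean) + `B8Eq119TwistedAxial.bgT_one`.

WHAT IS PROVED (kernel, 0 sorry, 0 def; [folklore] block bookkeeping — the cited sentences are print's definitions).
* §1 ★ `sum_blockOf_eq_sum_blockSites_liftSite` (`Σ_{x∈blockOf L′ m y} F x = Σ_{z∈blockSites L′ (liftSite y)} F (perSite z)` — the torus block IS the `ℤᵈ` block of the
  representative; NE9's `Q′(1)` as the `L′`-block mean is the tree's `B9Eq319QprimeLipschitz.QprimeLin_flat_apply`, USED), ★ `read_QprimeW_one` (`φ((QprimeW L′ m φ 1 u) y) = Σ_{z∈blockSites L′ (liftSite y)} L′^{−d}·(read u)(z)`).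
* §2 ★★ `read_QprimeW_one_pow_eq_QprimeIter` (AT `L′ = Lᵏ`: `φ((Q′^{(Lᵏ)}(1)u)(y)) = QprimeIter (zdBlocking d L) (bgT L 1) k (read u) (liftSite y)`),
  ★ `QprimeIter_one_add_period` (the `k`-fold flat block mean of an `Lᵏ·n`-periodic function is `n`-periodic in the block index),
  ★★ `QprimeW_one_pow_eq_zero_iff` (`QprimeW (Lᵏ) (fun _ => n) φ 1 u = 0 ↔ ∀ z, QprimeIter (zdBlocking d L) (bgT L 1) k (read u) z = 0` — THE `N(Q′)`-MATCH).

HONEST SCOPE.  Count-neutral helper (`--supports` the K1 item of record): index bookkeeping between two typings of print's (3.19) at the flat background;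
NO estimate; the `R`-letter identity itself (Hermitian symmetrisation + `B9Eq321ProjectionTransportZdPer` §1) is S2b part 2; Thm 3.11 ∕ 3.3 NOT proved;
N05 ∕ N06 NOT discharged; K1 NOT closed; one finite `𝕋⁴` programme at fixed `ε`, Bałaban as printed; R4 closes only the conditional finite-`𝕋⁴` rung
`BalabanLadder.UV` — nothing continuum ∕ ℝ⁴ ∕ OS ∕ mass gap ∕ Clay.  Unit `pub-ymgap-dag-n06-w3` (g6), 2026-08-28; NEW file importing
`B9Eq315PeriodicReadingZdPer`, `B9Eq326OperatorAssembly`, `B7Eq214FlatQprime`, `B8Eq119TwistedAxial`, `B5Eq172HodgePositivity`, `B9Eq319QprimeLipschitz`; modifies nothing.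
Net new unproved facts: 0.
-/

noncomputable section

open scoped BigOperators InnerProductSpace ComplexConjugate

namespace Literature.MathematicalPhysics.QuantumFieldTheory.Balaban1983to89.B9Eq319QprimeReadingZdPer

open B4Sect5Torus (TSite)
open B9SectCLatticeCarrier (Bond)
open B9Eq311L2Pairing (WL2)
open B11Eq103H1Complex (SiteL2K)
open B9Eq315QTorus (perSite perCfg cornerSite)
open B9Eq315QTorusOnto (liftSite periodVec perSite_liftSite perSite_add_periodVec liftSite_perSite_add cornerSite_eq)
open B9Eq319QprimeTorus (fineP Qprime QprimeLin QprimeLin_apply Qprime_flat)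
open B9Eq326OperatorAssembly (QprimeW)
open B9Eq310HessianOperator (adTransportW)
open B5Eq172HodgePositivity (adTransportW_one)
open B5Eq155FlatAveragingCommute (sum_blockOf_eq_sum_boxVec)
open B7Eq125RightInverse (corner corner_apply)
open B7Eq78Linearization (QprimeIter zdBlocking)
open B7Eq214FlatQprime (QprimeIter_one_eq_sum_blockSites sum_blockSites_eq_sum_boxVec)
open B8Eq119TwistedAxial (bgT bgT_one)
open Literature.MathematicalPhysics.QuantumLattice (blockSites)
open T4TermwiseTorus (IsPeriodic)
open B9Eq315PeriodicReadingZdPer (periodVec_const)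

variable {d : ℕ}

/-! ## §1  The torus block is the `ℤᵈ` block of the representative; NE9's `Q′(1)` read on `ℤᵈ` -/

section Blocks

variable (L' : ℕ) [NeZero L'] (m : Fin d → ℕ) [∀ i, NeZero (fineP L' m i)]

omit [NeZero L'] [∀ i, NeZero (fineP L' m i)] in
/-- the block corner `cornerSite L′ y = L′ • liftSite y`. [cite: Balaban1985Averaging, (2) p.17 (bookkeeping)] -/
theorem cornerSite_eq_smul_liftSite (y : TSite d m) : cornerSite L' y = (L' : ℤ) • liftSite y := by
  rw [cornerSite_eq]
  funext i
  rw [corner_apply, Pi.smul_apply, smul_eq_mul]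

/-- ★ **THE TORUS BLOCK `B(y)` IS THE `ℤᵈ` BLOCK OF THE REPRESENTATIVE**: `Σ_{x∈blockOf L′ m y} F x = Σ_{z∈blockSites L′ (liftSite y)} F (perSite z)` (both are
`Σ_{r∈[0,L′)ᵈ} F(read (L′y + r))` — `B5Eq155FlatAveragingCommute.sum_blockOf_eq_sum_boxVec` and `B7Eq214FlatQprime.sum_blockSites_eq_sum_boxVec`).
[cite: Balaban1985Averaging, (2) p.17] -/
theorem sum_blockOf_eq_sum_blockSites_liftSite {M : Type*} [AddCommMonoid M] (F : TSite d (fineP L' m) → M) (y : TSite d m) :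
    ∑ x ∈ B9Eq319QprimeTorus.blockOf L' m y, F x = ∑ z ∈ blockSites L' (liftSite y), F (perSite (fineP L' m) z) := by
  rw [sum_blockOf_eq_sum_boxVec, sum_blockSites_eq_sum_boxVec, cornerSite_eq_smul_liftSite]

variable {𝔸 : Type*} [CStarAlgebra 𝔸] {n' : ℕ} {c₀ : ℝ} (φ : EuclideanSpace ℂ (Fin n') ≃ₗ[ℂ] 𝔸)

/-- ★ **NE9's `Q′(1)` READ ON `ℤᵈ` THROUGH THE FIBRE COORDINATES**: for `u : SiteL2K ℂ d (fineP L′ m) c₀ W`, `W := EuclideanSpace ℂ (Fin n)`,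
`φ((QprimeW L′ m φ 1 u)(y)) = Σ_{z∈blockSites L′ (liftSite y)} L′^{−d}·φ(u(z̄))`. [cite: Balaban1985BackgroundPropagators, (3.19) p.393; Balaban1985Averaging, (2) p.17] -/
theorem read_QprimeW_one (u : SiteL2K ℂ d (fineP L' m) c₀ (EuclideanSpace ℂ (Fin n'))) (y : TSite d m) :
    φ (QprimeW L' m φ (fun _ : Bond d (fineP L' m) => (1 : 𝔸ˣ)) u y) =
      ∑ z ∈ blockSites L' (liftSite y), ((L' : ℝ) ^ d)⁻¹ • φ (WL2.equiv ℂ _ _ u (perSite (fineP L' m) z)) := by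
  have h1 : (adTransportW φ fun _ : Bond d (fineP L' m) => (1 : 𝔸ˣ)) =
      fun _ : Bond d (fineP L' m) => (LinearMap.id : EuclideanSpace ℂ (Fin n') →ₗ[ℂ] EuclideanSpace ℂ (Fin n')) :=
    funext fun b => adTransportW_one φ b
  rw [QprimeW, LinearMap.comp_apply, h1]
  change φ (QprimeLin L' m (fun _ => LinearMap.id) (WL2.equiv ℂ _ _ u) y) = _
  rw [B9Eq319QprimeLipschitz.QprimeLin_flat_apply, map_sum, sum_blockOf_eq_sum_blockSites_liftSite]
  refine Finset.sum_congr rfl fun z _ => ?_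
  rw [← Complex.coe_smul, map_smul, Complex.coe_smul]

end Blocks

/-! ## §2  At `L′ = Lᵏ`: NE9's one-step `Q′(1)` is dag-n06-w4's `k`-fold `Q′_k(1)`; the kernels agree -/

section Match

variable (L : ℕ) [NeZero L] (k n : ℕ) [NeZero n] {𝔸 : Type*} [CStarAlgebra 𝔸] {n' : ℕ} {c₀ : ℝ}
  (φ : EuclideanSpace ℂ (Fin n') ≃ₗ[ℂ] 𝔸)

/-- ★★ **AT BLOCK SIZE `Lᵏ`, NE9's ONE-STEP `Q′(1)` READ ON `ℤᵈ` IS THE `k`-FOLD `Q′_k(1)` OF THE N06 JUNCTION** ([B5] (1.18) «Q₂ is defined as Q only with L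
replaced by L²», [B7] p. 39): `φ((QprimeW (Lᵏ) (n,…,n) φ 1 u)(y)) = QprimeIter (zdBlocking d L) (bgT L 1) k (read u) (liftSite y)`, `read u := z ↦ φ(u(z̄))`.
[cite: Balaban1985BackgroundPropagators, (3.18)–(3.19) p.393; Balaban1984PropagatorsI, (1.18) p.20; Balaban1985Averaging, p.39] -/
theorem read_QprimeW_one_pow_eq_QprimeIter (hL : 1 ≤ L) (u : SiteL2K ℂ d (fineP (L ^ k) (fun _ : Fin d => n)) c₀ (EuclideanSpace ℂ (Fin n')))
    (y : TSite d (fun _ : Fin d => n)) :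
    φ (QprimeW (L ^ k) (fun _ : Fin d => n) φ (fun _ => (1 : 𝔸ˣ)) u y) =
      QprimeIter (zdBlocking d L) (bgT L (1 : B7Prop1Explicit.Site d → Fin d → 𝔸ˣ)) k
        (fun z => φ (WL2.equiv ℂ _ _ u (perSite (fineP (L ^ k) (fun _ : Fin d => n)) z))) (liftSite y) := by
  rw [read_QprimeW_one, bgT_one, QprimeIter_one_eq_sum_blockSites hL]
  refine Finset.sum_congr rfl fun z _ => ?_
  rw [Nat.cast_pow, ← pow_mul]

omit [NeZero L] [NeZero n] in
/-- ★ **THE FLAT `k`-FOLD BLOCK MEAN OF AN `Lᵏ·n`-PERIODIC FUNCTION IS `n`-PERIODIC IN THE BLOCK INDEX**: `Q′_k(1)f (z + n•t) = Q′_k(1)f (z)` (the block of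
`z + n•t` is the block of `z` translated by the period `Lᵏn•t`). [cite: Balaban1985Averaging, (2) p.17, (212) p.50] -/
theorem QprimeIter_one_add_period (hL : 1 ≤ L) {f : B7Prop1Explicit.Site d → 𝔸} (hf : IsPeriodic (L ^ k * n) f) (z t : B7Prop1Explicit.Site d) :
    QprimeIter (zdBlocking d L) (bgT L (1 : B7Prop1Explicit.Site d → Fin d → 𝔸ˣ)) k f (z + (n : ℤ) • t) =
      QprimeIter (zdBlocking d L) (bgT L (1 : B7Prop1Explicit.Site d → Fin d → 𝔸ˣ)) k f z := by
  rw [bgT_one, QprimeIter_one_eq_sum_blockSites hL, QprimeIter_one_eq_sum_blockSites hL, sum_blockSites_eq_sum_boxVec, sum_blockSites_eq_sum_boxVec]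
  refine Finset.sum_congr rfl fun r _ => ?_
  have h : ((L : ℤ) ^ k) • (z + (n : ℤ) • t) + B7Prop1Explicit.boxVec (L ^ k) r =
      ((L : ℤ) ^ k) • z + B7Prop1Explicit.boxVec (L ^ k) r + ((L ^ k * n : ℕ) : ℤ) • t := by
    rw [smul_add, smul_smul, Nat.cast_mul, Nat.cast_pow]; abel
  rw [Nat.cast_pow, h, hf]

/-- ★★ **THE `N(Q′)`-MATCH**: at block size `Lᵏ` on the fine torus of periods `Lᵏ·n`, NE9's `Q′(1)u = 0` iff the N06 junction's `Q′_k(1)` of the reading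
vanishes at EVERY block index of `ℤᵈ` (`φ` is injective; the reading's block means are `n`-periodic and `liftSite` hits every class).
[cite: Balaban1985BackgroundPropagators, (3.19) p.393, (3.21) p.394 («N(Q′) = {λ : Q′λ = 0}»)] -/
theorem QprimeW_one_pow_eq_zero_iff (hL : 1 ≤ L) (u : SiteL2K ℂ d (fineP (L ^ k) (fun _ : Fin d => n)) c₀ (EuclideanSpace ℂ (Fin n'))) :
    QprimeW (L ^ k) (fun _ : Fin d => n) φ (fun _ => (1 : 𝔸ˣ)) u = 0 ↔
      ∀ z : B7Prop1Explicit.Site d, QprimeIter (zdBlocking d L) (bgT L (1 : B7Prop1Explicit.Site d → Fin d → 𝔸ˣ)) k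
        (fun x => φ (WL2.equiv ℂ _ _ u (perSite (fineP (L ^ k) (fun _ : Fin d => n)) x))) z = 0 := by
  -- the reading is `Lᵏ·n`-periodic
  have hper : IsPeriodic (L ^ k * n) (fun x => φ (WL2.equiv ℂ _ _ u (perSite (fineP (L ^ k) (fun _ : Fin d => n)) x))) := by
    intro x t
    show φ (WL2.equiv ℂ _ _ u (perSite (fineP (L ^ k) (fun _ : Fin d => n)) (x + ((L ^ k * n : ℕ) : ℤ) • t))) = _
    rw [← periodVec_const (L ^ k * n) t]
    have hfine : (fun _ : Fin d => L ^ k * n) = fineP (L ^ k) (fun _ : Fin d => n) := rfl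
    rw [hfine, perSite_add_periodVec]
  constructor
  · intro h z
    -- move `z` to the representative of its class on the COARSE torus
    have hz : z = liftSite (perSite (fun _ : Fin d => n) z) + (n : ℤ) • (fun i => z i / (n : ℤ)) := by
      have := liftSite_perSite_add (fun _ : Fin d => n) z
      rw [periodVec_const] at this
      exact this.symm
    rw [hz, QprimeIter_one_add_period L k n hL hper, ← read_QprimeW_one_pow_eq_QprimeIter L k n φ hL u, h]
    simp
  · intro h
    funext y
    apply φ.injective
    rw [read_QprimeW_one_pow_eq_QprimeIter L k n φ hL u y, h (liftSite y), Pi.zero_apply, map_zero]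

end Match

end Literature.MathematicalPhysics.QuantumFieldTheory.Balaban1983to89.B9Eq319QprimeReadingZdPer

end
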